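import Literature.AnabelianGeometry.EtaleTheta.Discharge.Sec1TateTwistOfCyclotomicLevels
import HarnessLib

/-!
# [EtTh] §1 p. 12 «`Ẑ(1)`»: the CONVERSE of the Tate-twist criterion — a Tate twist carries cyclotomically
# equivariant level maps; so `IsTateTwist` ⟺ «`Π^tp_X` acts through the mod-`N` cyclotomic characters of `aug`»
# (the kernel locus of F-1697 for ARBITRARY data; proof-only, any field of characteristic `0`)

S. Mochizuki, *The étale theta function and its Frobenioid-theoretic manifestations*, Publ. RIMS **45** (2009)
[EtTh], §1, PRIMS PDF p. 12 (printed p. 238): «`1 → Ẑ(1) → Δ^ell_X → Ẑ → 1` … Thus, `(Δ^tp_Y)^ell ≅ Ẑ(1)`»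
[cite: MochizukiEtTh2009, §1 p.12] — `Ẑ(1) = lim_n μ_n(K̄)` as a `G_K`-module, typed by abc-iut-L3 as
`OncePuncturedTemperedGroup.IsTateTwist` (the common body of FACT-LIST F-0657 / F-0658 / F-0659 / F-1697).

Cell abc-iut, layer L2, seat abc-iut-L2-t7 (gen 4), sequel of `Sec1TateTwistOfCyclotomicLevels` (p444744: level
maps ⟹ Tate twist).  PROOF-ONLY (0 definitions).  Here the converse and the resulting characterisation:

* `OncePuncturedTemperedGroup.exists_cyclotomicLevels_of_isTateTwist` — if `T` (with the action `act` of `Π^tp_X`)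
  IS a Tate twist, then there are homomorphisms `λ_N : T → ℤ/N` (`N ≥ 1`), surjective, with open kernels,
  compatible, jointly injective and CYCLOTOMICALLY EQUIVARIANT («`λ_N (g·t) = k·λ_N t` whenever `aug g` acts on
  `μ_N(K̄)` as `ζ ↦ ζ^k`»): `λ_N :=` the discrete logarithm of the Tate-twist level map `ι_N : T ↠ μ_N(K̄)` to the
  base of a compatible system `ξ` of primitive roots of unity (abc-iut-w4-d024 / w5-d091's
  `cyclotome.exists_generator_mulEquiv_zHat_of_isSepClosed`: `t ↦ (ι_N t)_N` is an element of the cyclotome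
  `Λ(K̄ˣ) ≃ Ẑ`, and `λ_N = level_N ∘ (Λ(K̄ˣ) ≃ Ẑ)`);
* **`OncePuncturedTemperedGroup.isTateTwist_iff_exists_cyclotomicLevels`** — `IsTateTwist T act hact` ⟺ such a
  family exists.  In words: the typed «`≅ Ẑ(1)`» of a `Π^tp_X`-stable subgroup says EXACTLY that it is a procyclic
  `Ẑ` on which `Π^tp_X` acts through the cyclotomic character of `aug` — for EVERY datum (abc-iut-f-172's
  Galois-trivial locus `Sec1CyclotomicPackageGaloisLocus` is the case of the trivial action, where this forces
  «`G_K` fixes `μ_∞(K̄)`»; abc-iut-L2-t7's `SettingModelChiCyclotomicPackage` is a twisted instance).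

HONEST FRAMING: statements about OUR typed predicate on abstract data; [EtTh] is refereed, nothing of it is asserted;
no side taken on [IUTchIII] Cor. 3.12; typed ≠ proved.
-/

noncomputable section

namespace Literature.AnabelianGeometry.SemiGraphs

namespace OncePuncturedTemperedGroup

open Literature.AnabelianGeometry.EtaleTheta
open _root_.Topology
open CategoryTheory ProfiniteGrp ProfiniteGrp.ProfiniteCompletion

variable {K : Type} [Field K] (D : OncePuncturedTemperedGroup K)

/-- **A Tate twist carries cyclotomically equivariant level maps** ([EtTh] p. 12 «`Ẑ(1)`», converse of
`isTateTwist_of_cyclotomicLevels`).  `λ_N` is the discrete logarithm of the level map `ι_N : T ↠ μ_N(K̄)` of the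
Tate twist to the base of a compatible system of primitive roots of unity: surjective (so is `ι_N`), `Ker λ_N = Ker ι_N`
open, compatible (the family `(ι_N t)_N` is an element of the cyclotome), jointly injective (so is `(ι_N)_N`), and
`λ_N (g·t) = k·λ_N t` when `aug g` acts on `μ_N(K̄)` by `ζ ↦ ζ^k` (equivariance of `ι_N`).
[cite: MochizukiEtTh2009, §1 p.12] -/
theorem exists_cyclotomicLevels_of_isTateTwist [CharZero K] {A : Type} [Group A] [TopologicalSpace A]
    (T : Subgroup A) (act : D.Pi → A →* A) (hact : ∀ g, ∀ t ∈ T, act g t ∈ T) (h : D.IsTateTwist T act hact) :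
    ∃ lam : ∀ N : ℕ+, T →* Multiplicative (ZMod N),
      (∀ N : ℕ+, Function.Surjective (lam N)) ∧
      (∀ N : ℕ+, IsOpen ((lam N).ker : Set T)) ∧
      (∀ (N M : ℕ+) (t : T),
        (ZMod.castHom (dvd_mul_right (N : ℕ) M) (ZMod N)) (Multiplicative.toAdd (lam (N * M) t)) =
          Multiplicative.toAdd (lam N t)) ∧
      (∀ t : T, (∀ N : ℕ+, lam N t = 1) → t = 1) ∧
      ∀ (N : ℕ+) (g : D.Pi) (k : ℕ),
        (∀ ζ : (AlgebraicClosure K)ˣ, ζ ^ (N : ℕ) = 1 →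
          galApply (D.aug g) (ζ : AlgebraicClosure K) = ((ζ ^ k : (AlgebraicClosure K)ˣ) : AlgebraicClosure K)) →
        ∀ t : T, lam N ⟨act g t, hact g t t.2⟩ = lam N t ^ k := by
  classical
  haveI : CharZero (AlgebraicClosure K) :=
    charZero_of_injective_algebraMap (algebraMap K (AlgebraicClosure K)).injective
  obtain ⟨ι, h1, h2, h3, h4, h5, h6⟩ := h
  -- a compatible system of primitive roots of unity with its discrete-logarithm isomorphism `Λ(K̄ˣ) ≃ Ẑ`
  obtain ⟨ξ, e, hξ, -, he⟩ := cyclotome.exists_generator_mulEquiv_zHat_of_isSepClosed (AlgebraicClosure K)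
  -- `t ↦ (ι_N t)_N` lands in the cyclotome
  let Φ : ↥T →* cyclotome (AlgebraicClosure K)ˣ :=
    { toFun := fun t => ⟨fun N => ι N t, fun N => h1 N N.pos t, fun N M => h4 N M N.pos M.pos t⟩
      map_one' := Subtype.ext (funext fun N => by simp)
      map_mul' := fun s t => Subtype.ext (funext fun N => by simp) }
  have hΦ : ∀ (t : ↥T) (N : ℕ+), ((Φ t : cyclotome (AlgebraicClosure K)ˣ) : ℕ+ → (AlgebraicClosure K)ˣ) N = ι N t :=
    fun _ _ => rfl
  let lam : ∀ N : ℕ+, ↥T →* Multiplicative (ZMod N) := fun N => (ZHatLevel.level N).comp (e.toMonoidHom.comp Φ)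
  have hlam : ∀ (N : ℕ+) (t : ↥T), lam N t = ZHatLevel.level N (e (Φ t)) := fun _ _ => rfl
  -- key identity: `ξ_N ^ λ_N t = ι_N t`
  have hkey : ∀ (N : ℕ+) (t : ↥T),
      (ξ : ℕ+ → (AlgebraicClosure K)ˣ) N ^ (Multiplicative.toAdd (lam N t)).val = ι N t := by
    intro N t
    rw [hlam, he (Φ t) N, hΦ]
  -- `λ_N t = 1 ↔ ι_N t = 1`
  have hker : ∀ (N : ℕ+) (t : ↥T), lam N t = 1 ↔ ι N t = 1 := by
    intro N t
    haveI : NeZero (N : ℕ) := ⟨N.ne_zero⟩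
    rw [← hkey]
    constructor
    · intro h
      rw [h, toAdd_one, ZMod.val_zero, pow_zero]
    · intro h
      have hdvd := ((hξ N).pow_eq_one_iff_dvd _).mp h
      have hlt : (Multiplicative.toAdd (lam N t)).val < (N : ℕ) := ZMod.val_lt _
      have h0 : (Multiplicative.toAdd (lam N t)).val = 0 := Nat.eq_zero_of_dvd_of_lt hdvd hlt
      rw [ZMod.val_eq_zero] at h0
      rw [← ofAdd_toAdd (lam N t), h0, ofAdd_zero]
  refine ⟨lam, ?_, ?_, ?_, ?_, ?_⟩
  · -- surjective
    intro N y
    haveI : NeZero (N : ℕ) := ⟨N.ne_zero⟩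
    have hunit : ((ξ : ℕ+ → (AlgebraicClosure K)ˣ) N ^ (Multiplicative.toAdd y).val) ^ (N : ℕ) = 1 := by
      rw [pow_right_comm, cyclotome.pow_eq_one ξ N, one_pow]
    obtain ⟨t, ht⟩ := h2 N N.pos _ hunit
    refine ⟨t, ?_⟩
    have hexp := hkey N t
    rw [ht, cyclotome.pow_eq_pow_iff_mod_eq (hξ N), Nat.mod_eq_of_lt (ZMod.val_lt _),
      Nat.mod_eq_of_lt (ZMod.val_lt _)] at hexp
    rw [← ofAdd_toAdd (lam N t), ← ofAdd_toAdd y, ZMod.val_injective _ hexp]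
  · -- open kernels: `Ker λ_N = Ker ι_N`
    intro N
    have hset : ((lam N).ker : Set ↥T) = ((ι N).ker : Set ↥T) := by
      ext t
      rw [SetLike.mem_coe, SetLike.mem_coe, MonoidHom.mem_ker, MonoidHom.mem_ker, hker]
    rw [hset]
    exact h3 N N.pos
  · -- compatibility
    intro N M t
    rw [hlam, hlam]
    exact ZHatLevel.cast_level_mul N M _
  · -- jointly injective
    intro t ht
    exact h5 t fun n hn => by
      obtain ⟨N, rfl⟩ : ∃ N : ℕ+, (N : ℕ) = n := ⟨Nat.toPNat n hn, rfl⟩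
      exact (hker N t).mp (ht N)
  · -- cyclotomic equivariance
    intro N g k hk t
    haveI : NeZero (N : ℕ) := ⟨N.ne_zero⟩
    have hgt : (((ι N ⟨act g t, hact g t t.2⟩ : (AlgebraicClosure K)ˣ) : AlgebraicClosure K)) =
        ((ι N t ^ k : (AlgebraicClosure K)ˣ) : AlgebraicClosure K) := by
      rw [h6 N N.pos g t]
      exact hk _ (h1 N N.pos t)
    have hgt' : ι N ⟨act g t, hact g t t.2⟩ = ι N t ^ k := Units.ext hgt
    have hexp : (ξ : ℕ+ → (AlgebraicClosure K)ˣ) N ^ (Multiplicative.toAdd (lam N ⟨act g t, hact g t t.2⟩)).val =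
        (ξ : ℕ+ → (AlgebraicClosure K)ˣ) N ^ ((Multiplicative.toAdd (lam N t)).val * k) := by
      rw [hkey, hgt', ← hkey, ← pow_mul]
    rw [cyclotome.pow_eq_pow_iff_mod_eq (hξ N), Nat.mod_eq_of_lt (ZMod.val_lt _)] at hexp
    rw [← ofAdd_toAdd (lam N ⟨act g t, hact g t t.2⟩), ← ofAdd_toAdd (lam N t), ← ofAdd_nsmul, nsmul_eq_mul,
      ← ZMod.natCast_zmod_val (Multiplicative.toAdd (lam N ⟨act g t, hact g t t.2⟩)), hexp, ZMod.natCast_mod,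
      Nat.cast_mul, ZMod.natCast_zmod_val, mul_comm]

/-- **«`≅ Ẑ(1)`» ⟺ cyclotomically equivariant level maps** ([EtTh] p. 12; the kernel locus of the typed
F-1697 body for ARBITRARY data): a `Π^tp_X`-stable subgroup `T` is a Tate twist in abc-iut-L3's sense IFF it carries a
compatible, jointly injective family of open-kernel surjections `T ↠ ℤ/N` on which `Π^tp_X` acts through the
mod-`N` cyclotomic characters of `aug`. [cite: MochizukiEtTh2009, §1 p.12] -/
theorem isTateTwist_iff_exists_cyclotomicLevels [CharZero K] {A : Type} [Group A] [TopologicalSpace A]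
    (T : Subgroup A) (act : D.Pi → A →* A) (hact : ∀ g, ∀ t ∈ T, act g t ∈ T) :
    D.IsTateTwist T act hact ↔
      ∃ lam : ∀ N : ℕ+, T →* Multiplicative (ZMod N),
        (∀ N : ℕ+, Function.Surjective (lam N)) ∧
        (∀ N : ℕ+, IsOpen ((lam N).ker : Set T)) ∧
        (∀ (N M : ℕ+) (t : T),
          (ZMod.castHom (dvd_mul_right (N : ℕ) M) (ZMod N)) (Multiplicative.toAdd (lam (N * M) t)) =
            Multiplicative.toAdd (lam N t)) ∧
        (∀ t : T, (∀ N : ℕ+, lam N t = 1) → t = 1) ∧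
        ∀ (N : ℕ+) (g : D.Pi) (k : ℕ),
          (∀ ζ : (AlgebraicClosure K)ˣ, ζ ^ (N : ℕ) = 1 →
            galApply (D.aug g) (ζ : AlgebraicClosure K) = ((ζ ^ k : (AlgebraicClosure K)ˣ) : AlgebraicClosure K)) →
          ∀ t : T, lam N ⟨act g t, hact g t t.2⟩ = lam N t ^ k :=
  ⟨D.exists_cyclotomicLevels_of_isTateTwist T act hact, fun ⟨lam, h1, h2, h3, h4, h5⟩ =>
    D.isTateTwist_of_cyclotomicLevels T act hact lam h1 h2 h3 h4 h5⟩

end OncePuncturedTemperedGroup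

end Literature.AnabelianGeometry.SemiGraphs

end
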